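import Summits.Ventures.HodgeRepro2.T5InertUnipotentCongruence

/-!
# The congruence filtration of the unipotent radical at an inert place, part 2: the indices
(cell pub-hodge-repro2, seat p3)

Tier-5 N3 support (continuation of file 195 `T5InertUnipotentCongruence`, towards the count
`deg Tₙ = (q³ + 1) q^{4n−3}` of T5-SATAKE-KERNEL-p3.md row 11). The `R`-coordinates of the congruence
unipotents `N_{a,b} = {n(ϖ^a x, ϖ^b z)}` are read modulo `ϖ` in the residue field `𝔽 = R/ϖ`:

* **`xres`** — the homomorphism `N_{a,b} → 𝔽`, `n(ϖ^a x, ϖ^b z) ↦ x mod ϖ`, with kernel `N_{a+1,b}` and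
  image everything (`xres_ker`, `xres_range`): hence **`relIndex_unipCong_succ_left`**
  `[N_{a,b} : N_{a+1,b}] = #𝔽`;
* **`zres`** — the homomorphism `n(ϖ^a x, ϖ^b z) ↦ z mod ϖ` (a homomorphism when `b + 1 ≤ 2a`), with kernel
  `N_{a,b+1}` and image the TRACE-ZERO part `traceZero R E = {t ∈ 𝔽 : t + t̄ = 0}` of the residue field
  (`zres_ker`, `zres_range`): hence **`relIndex_unipCong_succ_right`**
  `[N_{a,b} : N_{a,b+1}] = #{t ∈ 𝔽 : t + t̄ = 0}`.

The only hypothesis beyond p8's standing ones (`R` a DVR with finite residue field, `E = Frac R`, the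
involution `star` preserving integrality, the star-fixed unit `u`, the uniformiser `ϖ` with star-fixed image)
is the trace lift `htr : ∃ e ∈ R, e + star e = 1` (automatic at an inert place, where the residue involution
is non-trivial, and whenever `2` is a unit). The next file transports these indices to the congruence
subgroups `K_{a,b}` of `K` through the Iwahori factorisation `K_{a,b} = N_{a,b} · (K ∩ B⁻)`.

Mathlib + this seat's file 195 and its imports; no display; no device.
§8(d): uses an L-value-free non-vanishing device: NO.
-/

namespace Summit.Ventures.HodgeRepro2.T5InertUnipotentResidue

open Matrix
open Summit.Ventures.HodgeRepro2.T5CartanCellsDistinct Summit.Ventures.HodgeRepro2.T5HermitianThreeElements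
  Summit.Ventures.HodgeRepro2.T5UnitaryGroupForm Summit.Ventures.HodgeRepro2.T5UnitaryThreeCorner
  Summit.Ventures.HodgeRepro2.T5UnitaryHeckeAdjoint Summit.Ventures.HodgeRepro2.T5InertUnipotentCongruence

/-! ## The coordinate maps to the residue field -/

section Residue

variable {R E : Type*} [CommRing R] [IsDomain R] [IsDiscreteValuationRing R] [Field E] [StarRing E]
  [Algebra R E] [IsFractionRing R E]
  (hstar : ∀ x : E, IsLocalization.IsInteger R x → IsLocalization.IsInteger R (star x))
  (u : E) (hsu : star u = u) (hu0 : u ≠ 0) (hu' : IsLocalization.IsInteger R u⁻¹)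
  {ϖ : R} (hϖ : Irreducible ϖ) (hs : star (algebraMap R E ϖ) = algebraMap R E ϖ)

include hϖ in
/-- `residue ϖ = 0`. -/
theorem residue_uniformiser : IsLocalRing.residue R ϖ = 0 := by
  rw [IsLocalRing.residue_eq_zero_iff, hϖ.maximalIdeal_eq]
  exact Ideal.mem_span_singleton_self ϖ

include hϖ in
/-- `residue x = 0 ↔ ϖ ∣ x`. -/
theorem residue_eq_zero_iff_dvd (x : R) : IsLocalRing.residue R x = 0 ↔ ϖ ∣ x := by
  rw [IsLocalRing.residue_eq_zero_iff, hϖ.maximalIdeal_eq, Ideal.mem_span_singleton]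

/-! ### The first coordinate map `N_{a,b} → 𝔽`, kernel `N_{a+1,b}`, image everything -/

/-- **The first coordinate map** `N_{a,b} → 𝔽`, `n(ϖ^a x, ϖ^b z) ↦ x mod ϖ` (a homomorphism). -/
noncomputable def xres (a b : ℕ) (hab : b ≤ 2 * a) :
    unipCong hstar u hu' hs a b hab →* Multiplicative (IsLocalRing.ResidueField R) where
  toFun g := Multiplicative.ofAdd (IsLocalRing.residue R (xcoord hstar u hu' hs g))
  map_one' := by rw [xcoord_one hstar u hu' hs hϖ, map_zero, ofAdd_zero]
  map_mul' g g' := by rw [xcoord_mul hstar u hu' hs hϖ, map_add, ofAdd_add]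

/-- **The trace-zero part of the residue field**: the classes of the `z ∈ R` with `z + z̄ = 0`. -/
def traceZero (R E : Type*) [CommRing R] [IsLocalRing R] [Field E] [StarRing E] [Algebra R E] :
    Set (IsLocalRing.ResidueField R) :=
  {t | ∃ z : R, IsLocalRing.residue R z = t ∧ algebraMap R E z + star (algebraMap R E z) = 0}

/-- **The second coordinate map** `N_{a,b} → 𝔽`, `n(ϖ^a x, ϖ^b z) ↦ z mod ϖ` (a homomorphism when
`b + 1 ≤ 2a`). -/
noncomputable def zres (a b : ℕ) (hab : b ≤ 2 * a) (hab1 : b + 1 ≤ 2 * a) :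
    unipCong hstar u hu' hs a b hab →* Multiplicative (IsLocalRing.ResidueField R) where
  toFun g := Multiplicative.ofAdd (IsLocalRing.residue R (zcoord hstar u hu' hs g))
  map_one' := by rw [zcoord_one hstar u hu' hs hϖ, map_zero, ofAdd_zero]
  map_mul' g g' := by
    obtain ⟨w, hw⟩ := zcoord_mul hstar u hu' hs hϖ g g'
    rw [hw, map_sub, map_add, map_mul, map_pow, residue_uniformiser hϖ,
      zero_pow (Nat.sub_ne_zero_of_lt hab1), zero_mul, sub_zero, ofAdd_add]

variable {a b : ℕ} {hab : b ≤ 2 * a}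

/-- The first coordinate map, unfolded. -/
theorem xres_apply (g : unipCong hstar u hu' hs a b hab) :
    xres hstar u hu' hϖ hs a b hab g =
      Multiplicative.ofAdd (IsLocalRing.residue R (xcoord hstar u hu' hs g)) := rfl

/-- **The kernel of the first coordinate map is `N_{a+1,b}`.** -/
theorem xres_ker (hab' : b ≤ 2 * (a + 1)) :
    (xres hstar u hu' hϖ hs a b hab).ker =
      (unipCong hstar u hu' hs (a + 1) b hab').subgroupOf (unipCong hstar u hu' hs a b hab) := by
  ext g
  rw [MonoidHom.mem_ker, Subgroup.mem_subgroupOf, xres_apply, mem_unipCong_iff]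
  have key : Multiplicative.ofAdd (IsLocalRing.residue R (xcoord hstar u hu' hs g)) = 1 ↔
      ϖ ∣ xcoord hstar u hu' hs g := by
    rw [← ofAdd_zero, Multiplicative.ofAdd.injective.eq_iff, residue_eq_zero_iff_dvd hϖ]
  rw [key]
  constructor
  · rintro ⟨x', hx'⟩
    refine ⟨x', zcoord hstar u hu' hs g, ?_⟩
    rw [coe_eq_upper3 hstar u hu' hs g, hx', map_mul, pow_succ, mul_assoc]
  · rintro ⟨x'', z'', h⟩
    refine ⟨x'', ?_⟩
    have := (coord_eq_of_coe_eq hstar u hu' hs hϖ (x := ϖ * x'') (z := z'') (by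
      rw [h, map_mul, pow_succ, mul_assoc])).1
    rw [this]

include hsu hu0 in
/-- **The first coordinate map is onto `𝔽`.** -/
theorem xres_range (htr : ∃ e : R, algebraMap R E e + star (algebraMap R E e) = 1) :
    (xres hstar u hu' hϖ hs a b hab).range = ⊤ := by
  rw [eq_top_iff]
  rintro t -
  obtain ⟨x, hx⟩ := IsLocalRing.residue_surjective (Multiplicative.toAdd t)
  obtain ⟨g, hg, z, hgz⟩ := exists_mem_unipCong_coe_eq hstar u hu' hs (a := a) (b := b) (hab := hab)
    hsu hu0 htr x
  refine ⟨⟨g, hg⟩, ?_⟩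
  rw [xres_apply, (coord_eq_of_coe_eq hstar u hu' hs hϖ hgz).1, hx]
  rfl

include hsu hu0 hϖ in
/-- **`[N_{a,b} : N_{a+1,b}] = #𝔽`.** -/
theorem relIndex_unipCong_succ_left (htr : ∃ e : R, algebraMap R E e + star (algebraMap R E e) = 1)
    (hab' : b ≤ 2 * (a + 1)) :
    (unipCong hstar u hu' hs (a + 1) b hab').relIndex (unipCong hstar u hu' hs a b hab) =
      Nat.card (IsLocalRing.ResidueField R) := by
  unfold Subgroup.relIndex
  rw [← xres_ker hstar u hu' hϖ hs hab', Subgroup.index_ker, xres_range hstar u hsu hu0 hu' hϖ hs htr,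
    Subgroup.card_top]
  exact Nat.card_congr Multiplicative.toAdd

/-! ### The second coordinate map `N_{a,b} → 𝔽`, kernel `N_{a,b+1}`, image the trace-zero part -/

/-- The second coordinate map, unfolded. -/
theorem zres_apply (hab1 : b + 1 ≤ 2 * a) (g : unipCong hstar u hu' hs a b hab) :
    zres hstar u hu' hϖ hs a b hab hab1 g =
      Multiplicative.ofAdd (IsLocalRing.residue R (zcoord hstar u hu' hs g)) := rfl

/-- **The kernel of the second coordinate map is `N_{a,b+1}`.** -/
theorem zres_ker (hab1 : b + 1 ≤ 2 * a) :
    (zres hstar u hu' hϖ hs a b hab hab1).ker =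
      (unipCong hstar u hu' hs a (b + 1) hab1).subgroupOf (unipCong hstar u hu' hs a b hab) := by
  ext g
  rw [MonoidHom.mem_ker, Subgroup.mem_subgroupOf, zres_apply, mem_unipCong_iff]
  have key : Multiplicative.ofAdd (IsLocalRing.residue R (zcoord hstar u hu' hs g)) = 1 ↔
      ϖ ∣ zcoord hstar u hu' hs g := by
    rw [← ofAdd_zero, Multiplicative.ofAdd.injective.eq_iff, residue_eq_zero_iff_dvd hϖ]
  rw [key]
  constructor
  · rintro ⟨z', hz'⟩
    refine ⟨xcoord hstar u hu' hs g, z', ?_⟩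
    rw [coe_eq_upper3 hstar u hu' hs g, hz', map_mul, pow_succ, mul_assoc]
  · rintro ⟨x'', z'', h⟩
    refine ⟨z'', ?_⟩
    have := (coord_eq_of_coe_eq hstar u hu' hs hϖ (x := x'') (z := ϖ * z'') (by
      rw [h, map_mul, pow_succ, mul_assoc])).2
    rw [this]

include hsu hu0 in
/-- **The image of the second coordinate map is the trace-zero part of `𝔽`** (the trace lift `e` moves a
representative with `z + z̄ ∈ ϖ R` to one with `z + z̄ = 0`). -/
theorem zres_range (htr : ∃ e : R, algebraMap R E e + star (algebraMap R E e) = 1)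
    (hab1 : b + 1 ≤ 2 * a) :
    ((zres hstar u hu' hϖ hs a b hab hab1).range : Set (Multiplicative (IsLocalRing.ResidueField R))) =
      Multiplicative.ofAdd '' traceZero R E := by
  obtain ⟨e, he⟩ := htr
  ext t
  rw [SetLike.mem_coe, MonoidHom.mem_range, Set.mem_image]
  constructor
  · rintro ⟨g, rfl⟩
    rw [zres_apply]
    refine ⟨IsLocalRing.residue R (zcoord hstar u hu' hs g), ?_, rfl⟩
    have hrel := zcoord_add_star_eq hstar u hu' hs hϖ hsu hu0 g
    obtain ⟨xs, hxs⟩ := hstar _ ⟨xcoord hstar u hu' hs g, rfl⟩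
    obtain ⟨u', hu''⟩ := id hu'
    have hxs' : star (algebraMap R E xs) = algebraMap R E (xcoord hstar u hu' hs g) := by
      rw [hxs, star_star]
    have hpow : algebraMap R E ϖ ^ (2 * a - b) =
        algebraMap R E ϖ * algebraMap R E ϖ ^ (2 * a - b - 1) := by
      rw [← pow_succ', Nat.sub_add_cancel (by omega : 1 ≤ 2 * a - b)]
    refine ⟨zcoord hstar u hu' hs g -
      e * ϖ * (-(ϖ ^ (2 * a - b - 1) * xs * xcoord hstar u hu' hs g * u')), ?_, ?_⟩
    · rw [map_sub, map_mul, map_mul, residue_uniformiser hϖ, mul_zero, zero_mul, sub_zero]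
    · simp only [map_sub, map_mul, map_neg, map_pow, star_sub, star_mul, star_neg, star_pow, hs,
        hu'', ← hxs, hxs', star_inv₀, hsu]
      rw [div_eq_mul_inv, ← hxs] at hrel
      linear_combination hrel + (algebraMap R E ϖ * algebraMap R E ϖ ^ (2 * a - b - 1) *
        algebraMap R E xs * algebraMap R E (xcoord hstar u hu' hs g) * u⁻¹) * he -
        (algebraMap R E xs * algebraMap R E (xcoord hstar u hu' hs g) * u⁻¹) * hpow
  · rintro ⟨s, ⟨z, rfl, hz⟩, rfl⟩
    have hmem : upper3 u (algebraMap R E ϖ ^ a * algebraMap R E 0)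
        (algebraMap R E ϖ ^ b * algebraMap R E z) ∈ formUnitaryGroup (J3 u) := by
      apply upper3_mem u hsu hu0
      rw [map_zero, mul_zero, star_zero, zero_mul, zero_div, add_zero, star_mul, star_pow, hs,
        mul_comm (star (algebraMap R E z)), ← mul_add, hz, mul_zero]
    refine ⟨⟨⟨_, hmem⟩, 0, z, rfl⟩, ?_⟩
    rw [zres_apply, (coord_eq_of_coe_eq hstar u hu' hs hϖ rfl).2]

include hsu hu0 hϖ in
/-- **`[N_{a,b} : N_{a,b+1}] = #{t ∈ 𝔽 : t + t̄ = 0}`** (for `b + 1 ≤ 2a`). -/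
theorem relIndex_unipCong_succ_right (htr : ∃ e : R, algebraMap R E e + star (algebraMap R E e) = 1)
    (hab1 : b + 1 ≤ 2 * a) :
    (unipCong hstar u hu' hs a (b + 1) hab1).relIndex (unipCong hstar u hu' hs a b hab) =
      Nat.card (traceZero R E) := by
  unfold Subgroup.relIndex
  rw [← zres_ker hstar u hu' hϖ hs hab1, Subgroup.index_ker]
  have h := zres_range hstar u hsu hu0 hu' hϖ hs (hab := hab) htr hab1
  have e1 : ((zres hstar u hu' hϖ hs a b hab hab1).range :
      Set (Multiplicative (IsLocalRing.ResidueField R))) ≃ traceZero R E :=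
    (Equiv.setCongr h).trans (Equiv.Set.image _ _ Multiplicative.ofAdd.injective).symm
  exact Nat.card_congr e1

end Residue

end Summit.Ventures.HodgeRepro2.T5InertUnipotentResidue
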